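import Mathlib
import Literature.NumberTheory.LFunctions.Zhang2022.Section11AFETailSmall
import HarnessLib

/-!
# Zhang (2022) §11, proof of Lemma 11.2 for `χψ` on the WIDENED height range `|t − 2πt₀| < 𝓛₁ + 2`
# — tools for (6.2): the rectangle and the pointwise size of the (6.2)-integrand, the outer half-lines

Topic `Literature/NumberTheory/LFunctions/Zhang2022` (Landau–Siegel audit tree; verdict-neutral).
Y. Zhang, *Discrete mean estimates and the Landau–Siegel zero*, arXiv:2211.02515v1 (2022)
[Zhang2022LandauSiegel] — **an unrefereed manuscript under adjudication** (campaign D-0069 /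
ZHANG-L discharge lane, WP12 helper H2-B; nothing here bears on Theorems 1–2 or on Landau–Siegel
zeros). Companion of `Section11AFETailTools` / `Section11AFETailSmall`.

WHY THIS FILE. The tree proves the repaired first display of the proof of Lemma 11.2
(`Section11AFE.step11u024e_holds`, node `Z22:§11.u024`) for `σ = 1/2`, `|t − 2πt₀| < 𝓛₁`
(`Section11AFE.InRange112`). §12 p. 67 (tex L3426–3429, node `Z22:§12.u009`) uses "the proof of
Lemma 11.2 with `s + β₆` in place of `s`" for the approximate functional equation of `H̃₁₅(s,ψ)`
(`Typed.Sec12A.Htilde15ApproxFE`), at points `s = ρ` with `|Im ρ − 2πt₀| < 𝓛₁`; since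
`β₆ = 3iα/2`, the point `s + β₆` lies OUTSIDE `InRange112` by up to `3α/2` at the top edge. Every use
of the height range in the §11 proof is soft (it enters only through Lemma 6.1's range
`Section6Statements.InRange61` = `|t − 2πt₀| < 𝓛₁ + 2` and the bounds `4𝓛⁵¹⁹ ≤ t − 𝓛²⁰`,
`t ≤ 8𝓛⁵¹⁹`), so the same proof gives the display on `|t − 2πt₀| < 𝓛₁ + 2`. This file and its
companions `Section11AFEWideTail`, `Section11AFEWideWindow`, `Section11AFEWideBlocks`,
`Section11AFEWide` re-run the §11 top layer VERBATIM with the hypothesis `InRange112 D s` replaced by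
`InRange61 D s ∧ σ = 1/2` (twins, suffix `_wide`; the narrow theorems are the special case).

PROVED here (theorem-only; 0 new definitions, 0 new facts), twins of the `Section11AFETailTools` /
`Section11AFETailSmall` lemmas of the same names without `_wide`:
* `rect_integrandTail_wide` — Cauchy's theorem on `[−𝓛⁹,−1] × [−𝓛²⁰,𝓛²⁰]` for the (6.2)-integrand;
* `norm_integrandTail_inner_le_wide` — `‖integrand(u+iv)‖ ≤ 12√P₁·e^{𝓛u}·e^{(u²−v²)/(4𝓛³⁰)}`;
* `norm_integral_outer_le_wide` — the outer half-lines `u = −1`, `|v| > 𝓛²⁰` (uses `σ = 1/2` only).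

## References

* Y. Zhang, arXiv:2211.02515v1 (2022), §6 proof of Lemma 6.1, (6.2) pp. 31–32; §11 Lemma 11.2
  p. 65; §12 p. 67 (tex L3426–3429). [cite: Zhang2022LandauSiegel, §6 (6.2); §11 Lemma 11.2; §12 p.67]
-/

noncomputable section

open Complex Real ComplexConjugate MeasureTheory Set Filter Topology

namespace Literature.NumberTheory.LFunctions.Zhang2022.Section11AFE

open Skeleton GaussWeight Section6Statements

section BlockDWide

variable {D : ℕ} [NeZero D] (χ : DirichletCharacter ℂ D) (x : Chr D)

/-! ## §1. The widened range inside the range of Lemma 6.1 -/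

omit [NeZero D] in
/-- The WIDENED range of Lemma 11.2 (`σ = 1/2`, `|t − 2πt₀| < 𝓛₁ + 2`) lies in the range of Lemma 6.1
(`|σ − 1/2| < 2α`, `|t − 2πt₀| < 𝓛₁ + 2`), `D ≥ 9`. [cite: Zhang2022LandauSiegel, §6 Lemma 6.1; §11 Lemma 11.2] -/
theorem inRange61_of_wide (hD : 9 ≤ D) {s : ℂ} (hre : s.re = 1 / 2)
    (him : |s.im - 2 * π * t0 D| < ell1 D + 2) : InRange61 D s := by
  have hℓ : 0 < ell D := by linarith [Section6TailBounds.two_le_ell hD]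
  have hα : 0 < alpha D := by
    rw [Section2.alpha_eq_pi_div_ell9]; exact div_pos Real.pi_pos (pow_pos hℓ 9)
  refine ⟨?_, him⟩
  rw [hre, sub_self, abs_zero]
  linarith

/-! ## §2. The rectangle `[−𝓛⁹, −1] × [−𝓛²⁰, 𝓛²⁰]` -/

/-- **The contour move of (6.2) for `χψ`, widened range** (twin of `rect_integrandTail`): for `D ≥ 9`,
`s` with `σ = 1/2` in the range of Lemma 6.1 and `X > 0`, the integral of the (6.2)-integrand over
`[−1−i𝓛²⁰, −1+i𝓛²⁰]` equals the integral over the three-sided path through `u = −𝓛⁹`.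
[cite: Zhang2022LandauSiegel, §6 pp. 31–32, tex L1735–1745; §11 p. 65] -/
theorem rect_integrandTail_wide (hD : 9 ≤ D) {s : ℂ} (hr61 : InRange61 D s) (hre : s.re = 1 / 2)
    {X : ℝ} (hX : 0 < X) (N : ℝ) :
    I * (∫ v in (-(ell D ^ 20))..(ell D ^ 20),
        integrandTail χ x X N s (((-1 : ℝ) : ℂ) + (v : ℂ) * I)) =
      (∫ u in (-1 : ℝ)..(-(ell D ^ 9)),
          integrandTail χ x X N s ((u : ℂ) + ((-(ell D ^ 20) : ℝ) : ℂ) * I)) +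
        I * (∫ v in (-(ell D ^ 20))..(ell D ^ 20),
          integrandTail χ x X N s (((-(ell D ^ 9) : ℝ) : ℂ) + (v : ℂ) * I)) +
        ∫ u in (-(ell D ^ 9))..(-1 : ℝ),
          integrandTail χ x X N s ((u : ℂ) + ((ell D ^ 20 : ℝ) : ℂ) * I) := by
  obtain ⟨him, _⟩ := Section6TailBounds.im_add_range hD hr61 (v := -(ell D ^ 20))
    (by rw [abs_neg, abs_of_nonneg (by positivity)])
  have hℓ := Section6TailBounds.two_le_ell hD
  set L : ℝ := ell D ^ 9 with hL
  set V : ℝ := ell D ^ 20 with hV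
  have h1 : (1 : ℝ) ≤ ell D := by linarith
  have hL1 : 1 ≤ L := one_le_pow₀ h1
  have hV0 : 0 ≤ V := by positivity
  have h519 : (2 : ℝ) ≤ ell D ^ 519 := Section6TailBounds.two_le_ell_pow hD (by norm_num)
  set f : ℂ → ℂ := integrandTail χ x X N s with hf
  set z : ℂ := ⟨-L, -V⟩ with hz
  set w : ℂ := ⟨-1, V⟩ with hw
  -- holomorphy on the closed rectangle `[−L,−1] × [−V,V]`
  have hdiff : DifferentiableOn ℂ f (Set.uIcc z.re w.re ×ℂ Set.uIcc z.im w.im) := by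
    intro q hq
    have hq' : q.re ∈ Set.uIcc (-L) (-1) ∧ q.im ∈ Set.uIcc (-V) V := by
      simpa [hz, hw, Complex.mem_reProdIm] using hq
    obtain ⟨hqre, hqim⟩ := hq'
    rw [Set.uIcc_of_le (by linarith), Set.mem_Icc] at hqre
    rw [Set.uIcc_of_le (by linarith), Set.mem_Icc] at hqim
    have hq0 : q ≠ 0 := by
      intro h; rw [h] at hqre; simp at hqre; linarith
    have him' : 0 < (s + q).im := by
      rw [add_im]; linarith
    have hre' : 1 < (1 - s - q).re := by simp [hre]; linarith
    exact (differentiableAt_integrandTail χ x hX N s hq0 him' hre').differentiableWithinAt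
  have key := Complex.integral_boundary_rect_eq_zero_of_differentiableOn f z w hdiff
  have hzre : z.re = -L := rfl
  have hzim : z.im = -V := rfl
  have hwre : w.re = -1 := rfl
  have hwim : w.im = V := rfl
  rw [hzre, hzim, hwre, hwim] at key
  simp only [smul_eq_mul] at key
  have e1 : (∫ y : ℝ in (-V)..V, f ((↑(-1 : ℝ) : ℂ) + y * I)) =
      ∫ y : ℝ in (-V)..V, f (((-1 : ℝ) : ℂ) + (y : ℂ) * I) := rfl
  rw [intervalIntegral.integral_symm (-L) (-1 : ℝ)]
  linear_combination key

/-! ## §3. The size of the (6.2)-integrand on `−𝓛⁹ ≤ u ≤ −1`, `|v| ≤ 𝓛²⁰` -/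

omit [NeZero D] in
/-- `B^{−u}X^uP^u = (B/(XP))^{−u}` for positive reals. [folklore] -/
private theorem rpow_ratio_eq' {B X P u : ℝ} (hB : 0 < B) (hX : 0 < X) (hP : 0 < P) :
    B ^ (-u) * (X ^ u * P ^ u) = (B / (X * P)) ^ (-u) := by
  have hXP : 0 < X * P := mul_pos hX hP
  rw [Real.div_rpow hB.le hXP.le, Real.rpow_neg hXP.le, div_inv_eq_mul, Real.mul_rpow hX.le hP.le]

/-- **The (6.2)-integrand for `χψ` on `−𝓛⁹ ≤ u ≤ −1`, `|v| ≤ 𝓛²⁰`, widened range** (twin of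
`norm_integrandTail_inner_le`): `‖Z(s+w,χψ)·tail·X^wω₁(w)/w‖ ≤ 12√P₁·e^{𝓛u}·e^{(u²−v²)/(4𝓛³⁰)}`.
[cite: Zhang2022LandauSiegel, §6 (6.2) p. 32, tex L1747–1751; §11 p. 65] -/
theorem norm_integrandTail_inner_le_wide (hD : 9 ≤ D) (hL : 5 ≤ ell D) (hp : χ.IsPrimitive)
    {s : ℂ} (hr61 : InRange61 D s) (hre : s.re = 1 / 2) {z : ℝ} (hz : 0.5 ≤ z) {u v : ℝ}
    (hu9 : -(ell D ^ 9) ≤ u) (hu1 : u ≤ -1) (hv : |v| ≤ ell D ^ 20) :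
    ‖integrandTail χ x (bigP D ^ z) (Skeleton.P1 D) s ((u : ℂ) + (v : ℂ) * I)‖ ≤
      12 * Real.sqrt (Skeleton.P1 D) * Real.exp (ell D * u) *
        Real.exp ((u ^ 2 - v ^ 2) / (4 * ell D ^ 30)) := by
  have hD3 : 3 ≤ D := le_trans (by norm_num) hD
  have hℓ0 : 0 < ell D := by linarith
  have hP : 0 < bigP D := Real.exp_pos _
  have hX : 0 < bigP D ^ z := Real.rpow_pos_of_pos hP z
  obtain ⟨hP1one, hsqrt⟩ := one_le_P1_and_sqrt D
  have hP10 : 0 < Skeleton.P1 D := by linarith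
  obtain ⟨htlo, hthi⟩ := Section6TailBounds.im_add_range hD hr61 hv
  have hσu := Section6TailBounds.abs_re_add_le hD hr61 hu9 hu1
  obtain ⟨hp1, hp2⟩ := Section6TailBounds.p_range hD x
  have hp0 : (0 : ℝ) < x.p := hP.trans hp1
  -- the point `s′ = s + w` and Stirling for `Z(·,χψ)`
  set θ := psiChi χ x with hθ
  have hprim : θ.IsPrimitive := psiChiPrimitive_holds D χ x hD3 hp
  set s' : ℂ := s + ((u : ℂ) + (v : ℂ) * I) with hs'
  have hre' : s'.re = s.re + u := by simp [hs']
  have him' : s'.im = s.im + v := by simp [hs']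
  have ht1 : 1 ≤ s'.im := by
    rw [him']; linarith [Section6TailBounds.two_le_ell_pow hD (n := 519) (by norm_num)]
  have hA : (1 : ℝ) ≤ ell D ^ 9 := by
    linarith [Section6TailBounds.two_le_ell_pow hD (n := 9) (by norm_num)]
  have hσA : |s'.re| ≤ ell D ^ 9 := by rw [hre']; exact hσu
  have htA : 38 * (ell D ^ 9 + 1) ^ 2 ≤ s'.im := by
    rw [him']; exact (Section6TailBounds.stirling_threshold_le hD).trans htlo
  have hZ := Section6TailBounds.norm_Zfac_le hprim hA hσA ht1 htA
  rw [hre', him', hre] at hZ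
  have hk : ((D * x.p : ℕ) : ℝ) = (D : ℝ) * x.p := by push_cast; ring
  rw [hk, show (1 / 2 - (1 / 2 + u) : ℝ) = -u by ring] at hZ
  -- the base `B = Dp(t+v)/2π` and the ratio
  set B : ℝ := (D : ℝ) * x.p * (s.im + v) / (2 * π) with hB
  have ht'0 : 0 < s.im + v := by linarith [Section6TailBounds.two_le_ell_pow hD (n := 519) (by norm_num)]
  have hD0 : (0 : ℝ) < D := by exact_mod_cast Nat.pos_of_ne_zero (NeZero.ne D)
  have hB0 : 0 < B := by rw [hB]; positivity
  have hρ : B / (bigP D ^ z * Skeleton.P1 D) ≤ Real.exp (-ell D) :=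
    ratio_le_exp_neg_ell hL hp2 ht'0 hthi hz
  have hρ0 : 0 ≤ B / (bigP D ^ z * Skeleton.P1 D) := div_nonneg hB0.le (mul_pos hX hP10).le
  have hu0 : 0 ≤ -u := by linarith
  have hρu : (B / (bigP D ^ z * Skeleton.P1 D)) ^ (-u) ≤ Real.exp (ell D * u) := by
    calc (B / (bigP D ^ z * Skeleton.P1 D)) ^ (-u) ≤ (Real.exp (-ell D)) ^ (-u) :=
          Real.rpow_le_rpow hρ0 hρ hu0
      _ = Real.exp (ell D * u) := by rw [← Real.exp_mul]; ring_nf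
  -- the four factors
  have hZn : ‖Zpc χ x s'‖ ≤ 4 * B ^ (-u) := hZ
  have hXn : ‖(((bigP D ^ z : ℝ) : ℂ)) ^ ((u : ℂ) + (v : ℂ) * I)‖ = (bigP D ^ z) ^ u := by
    rw [Complex.norm_cpow_eq_rpow_re_of_pos hX]; simp
  have hT := norm_tailPc_le χ x hre hP1one hu1 v
  have hω : ‖omega1 (ell D ^ 30) ((u : ℂ) + (v : ℂ) * I)‖ =
      Real.exp ((u ^ 2 - v ^ 2) / (4 * ell D ^ 30)) := norm_omega1 _ u v
  have hw1 : 1 ≤ ‖(u : ℂ) + (v : ℂ) * I‖ := by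
    have h := Complex.abs_re_le_norm ((u : ℂ) + (v : ℂ) * I)
    have hure : ((u : ℂ) + (v : ℂ) * I).re = u := by simp
    rw [hure, abs_of_nonpos (by linarith)] at h
    linarith
  -- the tail `3P₁^{1/2+u} = 3√P₁·P₁^u`
  have hTsplit : Skeleton.P1 D ^ (1 / 2 + u) = Real.sqrt (Skeleton.P1 D) * Skeleton.P1 D ^ u := by
    rw [Real.rpow_add hP10, Real.sqrt_eq_rpow]
  -- assemble
  have e : integrandTail χ x (bigP D ^ z) (Skeleton.P1 D) s ((u : ℂ) + (v : ℂ) * I) =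
      Zpc χ x s' * tailPc χ x (Skeleton.P1 D) s ((u : ℂ) + (v : ℂ) * I) *
        ((((bigP D ^ z : ℝ) : ℂ)) ^ ((u : ℂ) + (v : ℂ) * I) * omega1 (ell D ^ 30) ((u : ℂ) + (v : ℂ) * I)) /
          ((u : ℂ) + (v : ℂ) * I) := by
    rw [integrandTail, kern, hs']; ring
  have hnum0 : 0 ≤ 4 * B ^ (-u) * (3 * Skeleton.P1 D ^ (1 / 2 + u)) *
      ((bigP D ^ z) ^ u * Real.exp ((u ^ 2 - v ^ 2) / (4 * ell D ^ 30))) := by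
    have := Real.rpow_nonneg hB0.le (-u)
    have := Real.rpow_nonneg hP10.le (1 / 2 + u)
    have := Real.rpow_nonneg hX.le u
    positivity
  calc ‖integrandTail χ x (bigP D ^ z) (Skeleton.P1 D) s ((u : ℂ) + (v : ℂ) * I)‖
      = ‖Zpc χ x s'‖ * ‖tailPc χ x (Skeleton.P1 D) s ((u : ℂ) + (v : ℂ) * I)‖ *
          ((bigP D ^ z) ^ u * Real.exp ((u ^ 2 - v ^ 2) / (4 * ell D ^ 30))) /
            ‖(u : ℂ) + (v : ℂ) * I‖ := by
        rw [e, norm_div, norm_mul, norm_mul, norm_mul, hXn, hω]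
    _ ≤ 4 * B ^ (-u) * (3 * Skeleton.P1 D ^ (1 / 2 + u)) *
          ((bigP D ^ z) ^ u * Real.exp ((u ^ 2 - v ^ 2) / (4 * ell D ^ 30))) /
            ‖(u : ℂ) + (v : ℂ) * I‖ := by
        gcongr
    _ ≤ 4 * B ^ (-u) * (3 * Skeleton.P1 D ^ (1 / 2 + u)) *
          ((bigP D ^ z) ^ u * Real.exp ((u ^ 2 - v ^ 2) / (4 * ell D ^ 30))) := div_le_self hnum0 hw1
    _ = 12 * Real.sqrt (Skeleton.P1 D) * (B ^ (-u) * ((bigP D ^ z) ^ u * Skeleton.P1 D ^ u)) *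
          Real.exp ((u ^ 2 - v ^ 2) / (4 * ell D ^ 30)) := by rw [hTsplit]; ring
    _ = 12 * Real.sqrt (Skeleton.P1 D) * (B / (bigP D ^ z * Skeleton.P1 D)) ^ (-u) *
          Real.exp ((u ^ 2 - v ^ 2) / (4 * ell D ^ 30)) := by rw [rpow_ratio_eq' hB0 hX hP10]
    _ ≤ 12 * Real.sqrt (Skeleton.P1 D) * Real.exp (ell D * u) *
          Real.exp ((u ^ 2 - v ^ 2) / (4 * ell D ^ 30)) := by gcongr

/-! ## §4. The outer half-lines `u = −1`, `|v| > 𝓛²⁰` -/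

/-- **The outer half-lines of (6.2) for `χψ`** (twin of `norm_integral_outer_le`, which uses only
`σ = 1/2` of the range): the integral over `|v| > 𝓛²⁰` is
`≤ 3e·G·(Dp)²·e^{−𝓛¹⁰/8}·((4/β)√(π/(β/4)) + 2(|t|+2)²√(π/(β/2)))`, `β = 1/(4𝓛³⁰)`.
[cite: Zhang2022LandauSiegel, §6 (6.2) p. 32, tex L1746; §11 p. 65] -/
theorem norm_integral_outer_le_wide {G : ℝ} (hG0 : 0 < G)
    (hG : ∀ (k : ℕ) [NeZero k] (θ : DirichletCharacter ℂ k) (s' : ℂ), -1 ≤ s'.re → s'.re ≤ 0 →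
      ‖GammaFactor.Zfac θ s'‖ ≤ G * (k : ℝ) ^ 2 * (|s'.im| + 2) ^ 2)
    (hD : 9 ≤ D) {s : ℂ} (hre : s.re = 1 / 2) {z : ℝ} (hz : 0.5 ≤ z) :
    ‖∫ v in (Set.Ioc (-(ell D ^ 20)) (ell D ^ 20))ᶜ,
        integrandTail χ x (bigP D ^ z) (Skeleton.P1 D) s (((-1 : ℝ) : ℂ) + (v : ℂ) * I)‖ ≤
      3 * Real.exp 1 * G * ((D : ℝ) * x.p) ^ 2 *
        (Real.exp (-((1 / (4 * ell D ^ 30)) / 2) * (ell D ^ 20) ^ 2) *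
          (4 / (1 / (4 * ell D ^ 30)) * Real.sqrt (π / ((1 / (4 * ell D ^ 30)) / 4)) +
            2 * (|s.im| + 2) ^ 2 * Real.sqrt (π / ((1 / (4 * ell D ^ 30)) / 2)))) := by
  have hD2 : 2 ≤ D := le_trans (by norm_num) hD
  have hℓ := Section6TailBounds.two_le_ell hD
  have hℓ0 : 0 < ell D := by linarith
  have hP : 0 < bigP D := Real.exp_pos _
  have hP1' : (1 : ℝ) ≤ bigP D := Real.one_le_exp (pow_nonneg hℓ0.le 9)
  have hX : 0 < bigP D ^ z := Real.rpow_pos_of_pos hP z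
  have hX1 : 1 ≤ bigP D ^ z := Real.one_le_rpow hP1' (by linarith)
  obtain ⟨hP1one, _⟩ := one_le_P1_and_sqrt D
  set β : ℝ := 1 / (4 * ell D ^ 30) with hβ
  have hβ0 : 0 < β := by rw [hβ]; positivity
  have hβ1 : β ≤ 1 := by
    rw [hβ, div_le_one (by positivity)]
    have : (1 : ℝ) ≤ ell D ^ 30 := one_le_pow₀ (by linarith)
    linarith
  set V : ℝ := ell D ^ 20 with hV
  have hV0 : 0 ≤ V := by positivity
  set k : ℕ := D * x.p with hk
  have hkR : (k : ℝ) = (D : ℝ) * x.p := by rw [hk]; push_cast; ring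
  set A : ℝ := |s.im| + 2 with hA
  set F : ℝ → ℂ := fun v =>
    integrandTail χ x (bigP D ^ z) (Skeleton.P1 D) s (((-1 : ℝ) : ℂ) + (v : ℂ) * I) with hF
  set K : ℝ := 3 * Real.exp 1 * G * ((D : ℝ) * x.p) ^ 2 with hKdef
  have hK0 : 0 ≤ K := by rw [hKdef]; positivity
  -- pointwise majorant on `u = −1`
  have hpt : ∀ v : ℝ, ‖F v‖ ≤ K * ((|v| + A) ^ 2 * Real.exp (-β * v ^ 2)) := by
    intro v
    have hz1 : -1 ≤ (s + (((-1 : ℝ) : ℂ) + (v : ℂ) * I)).re := by norm_num [hre]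
    have hz2 : (s + (((-1 : ℝ) : ℂ) + (v : ℂ) * I)).re ≤ 0 := by norm_num [hre]
    have hZb := hG k (psiChi χ x) (s + (((-1 : ℝ) : ℂ) + (v : ℂ) * I)) hz1 hz2
    have him : |(s + (((-1 : ℝ) : ℂ) + (v : ℂ) * I)).im| + 2 ≤ |v| + A := by
      simp only [Complex.add_im, Complex.ofReal_im, Complex.mul_im, Complex.ofReal_re, Complex.I_im,
        Complex.I_re, mul_zero, mul_one, zero_add, add_zero, hA]
      have := abs_add_le s.im v
      linarith
    have him0 : 0 ≤ |(s + (((-1 : ℝ) : ℂ) + (v : ℂ) * I)).im| + 2 := by positivity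
    have hZb' : ‖Zpc χ x (s + (((-1 : ℝ) : ℂ) + (v : ℂ) * I))‖ ≤ G * (k : ℝ) ^ 2 * (|v| + A) ^ 2 := by
      refine hZb.trans ?_
      exact mul_le_mul_of_nonneg_left (pow_le_pow_left₀ him0 him 2) (by positivity)
    have hT : ‖tailPc χ x (Skeleton.P1 D) s (((-1 : ℝ) : ℂ) + (v : ℂ) * I)‖ ≤ 3 := by
      have h := norm_tailPc_le χ x hre hP1one (le_refl (-1 : ℝ)) v
      have h1 : Skeleton.P1 D ^ (1 / 2 + (-1 : ℝ)) ≤ 1 :=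
        Real.rpow_le_one_of_one_le_of_nonpos hP1one (by norm_num)
      linarith
    have hKb := norm_kern_neg_one_le (D := D) hX v
    rw [← hβ] at hKb
    have hXinv : (bigP D ^ z)⁻¹ * Real.exp β ≤ Real.exp 1 := by
      have h1 : (bigP D ^ z)⁻¹ ≤ 1 := inv_le_one_of_one_le₀ hX1
      have h2 : Real.exp β ≤ Real.exp 1 := Real.exp_le_exp.mpr hβ1
      calc (bigP D ^ z)⁻¹ * Real.exp β ≤ 1 * Real.exp 1 :=
            mul_le_mul h1 h2 (Real.exp_pos _).le zero_le_one
        _ = Real.exp 1 := one_mul _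
    have hKb' : ‖kern D (bigP D ^ z) (((-1 : ℝ) : ℂ) + (v : ℂ) * I)‖ ≤
        Real.exp 1 * Real.exp (-β * v ^ 2) :=
      hKb.trans (mul_le_mul_of_nonneg_right hXinv (Real.exp_pos _).le)
    calc ‖F v‖
        = ‖Zpc χ x (s + (((-1 : ℝ) : ℂ) + (v : ℂ) * I))‖ *
          ‖tailPc χ x (Skeleton.P1 D) s (((-1 : ℝ) : ℂ) + (v : ℂ) * I)‖ *
          ‖kern D (bigP D ^ z) (((-1 : ℝ) : ℂ) + (v : ℂ) * I)‖ := by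
          simp only [hF, integrandTail, norm_mul]
      _ ≤ (G * (k : ℝ) ^ 2 * (|v| + A) ^ 2) * 3 * (Real.exp 1 * Real.exp (-β * v ^ 2)) := by
        gcongr
      _ = K * ((|v| + A) ^ 2 * Real.exp (-β * v ^ 2)) := by rw [hKdef, hkR]; ring
  -- integrate the majorant over `|v| > V`
  set S : Set ℝ := (Set.Ioc (-V) V)ᶜ with hS
  have hgi : Integrable fun v : ℝ => K * ((|v| + A) ^ 2 * Real.exp (-β * v ^ 2)) :=
    (integrable_absAddSq_mul_gauss hβ0 A).const_mul K
  have h1 : ‖∫ v in S, F v‖ ≤ ∫ v in S, K * ((|v| + A) ^ 2 * Real.exp (-β * v ^ 2)) :=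
    norm_integral_le_of_norm_le hgi.integrableOn (ae_of_all _ fun v => hpt v)
  have h2 : ∫ v in S, K * ((|v| + A) ^ 2 * Real.exp (-β * v ^ 2)) =
      K * ∫ v in S, (|v| + A) ^ 2 * Real.exp (-β * v ^ 2) := integral_const_mul _ _
  have h3 := gauss_tail_quad_le hβ0 A hV0
  rw [← hS] at h3
  calc ‖∫ v in S, F v‖ ≤ K * ∫ v in S, (|v| + A) ^ 2 * Real.exp (-β * v ^ 2) := by rw [← h2]; exact h1
    _ ≤ K * (Real.exp (-(β / 2) * V ^ 2) *
          (4 / β * Real.sqrt (π / (β / 4)) + 2 * A ^ 2 * Real.sqrt (π / (β / 2)))) :=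
        mul_le_mul_of_nonneg_left h3 hK0

end BlockDWide

end Literature.NumberTheory.LFunctions.Zhang2022.Section11AFE
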